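import Literature.Computability.Cryptography.CubicClassTable
import Literature.NumberTheory.CubicFields.PureCubicLatticeCodes
import Literature.NumberTheory.CubicFields.VoronoiChain
import Mathlib.NumberTheory.NumberField.ClassNumber
import Mathlib.NumberTheory.NumberField.Units.Regulator
import HarnessLib

/-!
# The power-walk class table: corrected unit-label specification and structural interface (definitions)

Topic `Computability/Cryptography`; DEFINITIONS ONLY (named `Prop`s), second companion of `CubicClassTable.lean` (the first,
`CubicClassTableSpecs.lean`, names `RedSem`, `UnitSem`, `LatProdSem`, `PrimeSem`, `RootsSem`, `ClassTableInterface`). The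
semantics part of the line `arakelov-giant-step-cycle` (crux `LinnikCubicClassGroups.PureCubicClassGroupFBQP`) found the first
interface unprovable as filed and these are the repaired forms it proves:
* `UnitSem'` — as `UnitSem` plus the UPPER bound `log σ₁ υ ≤ 6 log(27a²b²) + 8` on the unit label's log (true for the
  program's label `θ_{s0}`, `s0 ≤ 5`; without it the step `o⋆` of the power walk is unbounded and the walk degenerates);
* `ClassTableInterface'` — as `ClassTableInterface` with `m = a b²` (the roots fed to the prime codes must be cube roots of
  `ab²`, not of the given radicand `f³ab²`), `cap ≥ (243a²b²)²` also when `ps = []`, absolute caps `|ps|, ℓe ≤ 2^32` (bad-coin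
  union bound; `±1`-per-reduction rounding budget), and the vacuous code-size hypothesis dropped; conclusion verbatim.
[Hallgren 2005, §4; Buchmann–Williams 1988, §3]

## References

* S. Hallgren, STOC 2005, §4. [Hallgren2005]
* J. Buchmann, H. C. Williams, Math. Comp. 50 (1988), §3. [BuchmannWilliams1988]
-/

noncomputable section

namespace Literature.Computability.Cryptography

namespace CubicClassTable

open Literature.NumberTheory.CubicFields (posRelMinima PureCubicCodes.Mem PureCubicCodes.Canon)
open scoped NumberField nonZeroDivisors


/-- **The unit label and the filtered step beyond it, semantically** (corrected: the unit label's log is ALSO bounded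
above, `log σ₁ υ ≤ 6 log(27a²b²) + 8`, as it is for the program's `υ = θ_{s 0}`, `s 0 ≤ 5`; without it `ostar` is
unbounded and the power walk degenerates). [cite: BuchmannWilliams1988, §3] -/
def UnitSem' (F : CubicClassTable.WalkFns) (a b : ℕ) (K : Type*) [Field K] [NumberField K] (θ : K)
    (σ₁ : K →+* ℝ) (σ₂ : K →+* ℂ) : Prop :=
  ∀ prec : ℕ, 4 * Nat.size (a * b) + 8 ≤ prec →
        ∃ υ υ' : K, 0 < σ₁ υ ∧ 0 < σ₁ υ' ∧
          (1 : K) ∈ posRelMinima σ₁ σ₂ (FractionalIdeal.spanSingleton (𝓞 K)⁰ υ⁻¹) ∧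
          (1 : K) ∈ posRelMinima σ₁ σ₂ (FractionalIdeal.spanSingleton (𝓞 K)⁰ υ'⁻¹) ∧
          PureCubicCodes.Canon (F.unitS ((a, b), prec)).1 ∧ (∀ φ : K, PureCubicCodes.Mem θ b (F.unitS ((a, b), prec)).1 φ ↔ φ * υ ∈ (1 : FractionalIdeal (𝓞 K)⁰ K)) ∧
          |((F.unitS ((a, b), prec)).2 : ℝ) - 2 ^ prec * Real.log (σ₁ υ)| ≤ 8 ∧ 0 ≤ Real.log (σ₁ υ) ∧
          Real.log (σ₁ υ) ≤ 6 * Real.log (27 * (a : ℝ) ^ 2 * (b : ℝ) ^ 2) + 8 ∧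
          PureCubicCodes.Canon (F.rhoS (((a, b), prec), (F.unitS ((a, b), prec)).1)).1 ∧
          (∀ φ : K, PureCubicCodes.Mem θ b (F.rhoS (((a, b), prec), (F.unitS ((a, b), prec)).1)).1 φ ↔ φ * υ' ∈ (1 : FractionalIdeal (𝓞 K)⁰ K)) ∧
          |((F.rhoS (((a, b), prec), (F.unitS ((a, b), prec)).1)).2 : ℝ) - 2 ^ prec * Real.log (σ₁ υ' / σ₁ υ)| ≤ 8 ∧
          Real.log (11 / 10) ≤ Real.log (σ₁ υ' / σ₁ υ) ∧ Real.log (σ₁ υ' / σ₁ υ) ≤ 4 * Real.log (27 * (a : ℝ) ^ 2 * (b : ℝ) ^ 2) + 8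

/-- **The structural interface of the power-walk class table** (corrected hypotheses: `m = a b²` — the roots fed to
`primeL` must be cube roots of `ab²`; `cap ≥ (243a²b²)²` also when `ps = []`; absolute caps `|ps|, ℓe ≤ 2^32` for the
bad-coin union bound and the `±1`-per-reduction rounding budget; the vacuous code-size hypothesis dropped). Conclusion
verbatim as in `ClassTableInterface`. [cite: Hallgren2005, §4] -/
def ClassTableInterface' (F : CubicClassTable.WalkFns) (a b : ℕ) (K : Type*) [Field K] [NumberField K]
    (ord : ℕ × List ℤ) : Prop :=
  ∀ (m : ℕ) (ps : List ℕ) (r k : ℕ), (∀ p ∈ ps, p.Prime ∧ ¬ p ∣ 3 * m) → m = a * b ^ 2 →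
      |(r : ℝ) - 2 ^ k * NumberField.Units.regulator K| ≤ 1 →
      ∀ (ℓe npp ℓy ℓκ ℓb prec s s₀ Tdbl Bfin Bb margin cap : ℕ),
        20 ≤ ℓe → ℓe ≤ 2 ^ 32 → ps.length ≤ 2 ^ 32 →
        s + npp + 60 + 6 * Nat.size (27 * a ^ 2 * b ^ 2) ≤ k → k + s + npp + 64 ≤ prec → npp + 6 * Nat.size (27 * a ^ 2 * b ^ 2) + 50 ≤ s → s ≤ ℓy →
        prec + 6 * Nat.size (27 * a ^ 2 * b ^ 2) + 10 ≤ Tdbl → margin = 2 ^ prec * ((2 * Tdbl + 4) * (10 * Nat.size (a * b) + 48)) →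
        60 * (2 * Tdbl + 4) * (10 * Nat.size (a * b) + 48) + 12 ≤ Bb →
        (243 * a ^ 2 * b ^ 2) ^ 2 ≤ cap → (∀ p ∈ ps, (243 * a ^ 2 * b ^ 2 * (p + 1)) ^ 2 ≤ cap) →
        ℓb = 24 * (Nat.size cap + 2) * 50 → ps.length * ℓb ≤ ℓκ →
        ∃ (Λ : AddSubgroup (Fin (3 * ps.length) → ℤ)) (_ : Λ.FiniteIndex)
          (F₀ : ℕ → (ℕ × List ℤ) × ℕ) (cls σ : ℕ → ℕ) (C : ℕ → ℕ → (ℕ × List ℤ) × ℕ) (y : ℕ → ℝ)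
          (μ : Fin (3 * ps.length) → ℝ) (Badκ D : Finset ℕ),
          Λ.index = Nat.card (Subgroup.closure {c : ClassGroup (𝓞 K) | ∃ p ∈ ps, ∃ P : Ideal (𝓞 K),
            ∃ hP : P ∈ nonZeroDivisors (Ideal (𝓞 K)), c = ClassGroup.mk0 ⟨P, hP⟩ ∧ P.IsPrime ∧ Ideal.absNorm P = p}) ∧
          (Badκ.card : ℝ) ≤ (1 / 2) ^ 40 * 2 ^ ℓκ ∧
          (∀ v : ℕ, (v / ((2 ^ ℓe) ^ (3 * ps.length) * 2 ^ ℓy)) % 2 ^ ℓκ ∉ Badκ →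
            F.classTableOpP ⟨a, b, m, ps, ord, r, k, prec, s, ℓe, npp, ℓy, ℓκ, ℓb, s₀, Tdbl, Bfin, Bb, margin⟩ cap v =
              F₀ (v % ((2 ^ ℓe) ^ (3 * ps.length) * 2 ^ ℓy))) ∧
          (D.card : ℝ) ≤ (1 / 2) ^ 30 * ((2 ^ ℓe) ^ (3 * ps.length) * 2 ^ ℓy : ℕ) ∧
          (∀ E < (2 ^ ℓe) ^ (3 * ps.length), ∀ j < 2 ^ ℓy, E + (2 ^ ℓe) ^ (3 * ps.length) * j ∉ D →
            F₀ (E + (2 ^ ℓe) ^ (3 * ps.length) * j) = C (cls E) ((σ E + j) % 2 ^ s)) ∧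
          (∀ E < (2 ^ ℓe) ^ (3 * ps.length), ∀ E' < (2 ^ ℓe) ^ (3 * ps.length), cls E = cls E' ↔
            (fun t : Fin (3 * ps.length) => ((E / (2 ^ ℓe) ^ (t : ℕ) % 2 ^ ℓe : ℕ) : ℤ) -
              ((E' / (2 ^ ℓe) ^ (t : ℕ) % 2 ^ ℓe : ℕ) : ℤ)) ∈ Λ) ∧
          (∀ E < (2 ^ ℓe) ^ (3 * ps.length), ∀ E' < (2 ^ ℓe) ^ (3 * ps.length), ∀ i < 2 ^ s, ∀ i' < 2 ^ s,
            C (cls E) i = C (cls E') i' → cls E = cls E') ∧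
          (∀ E < (2 ^ ℓe) ^ (3 * ps.length), |(σ E : ℝ) - y E| ≤ 1) ∧
          (∀ E < (2 ^ ℓe) ^ (3 * ps.length), ∀ E' < (2 ^ ℓe) ^ (3 * ps.length), cls E = cls E' →
            ∃ z : ℤ, y E' - y E + 2 ^ s * ∑ t : Fin (3 * ps.length), μ t *
              (((E' / (2 ^ ℓe) ^ (t : ℕ) % 2 ^ ℓe : ℕ) : ℝ) - ((E / (2 ^ ℓe) ^ (t : ℕ) % 2 ^ ℓe : ℕ) : ℝ)) = 2 ^ s * z) ∧
          (∀ E < (2 ^ ℓe) ^ (3 * ps.length),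
            (∀ ω ∈ (Finset.range (2 ^ s)).image (C (cls E)), ∃ b₁ b₂ b₁' b₂' : ℕ,
              Disjoint (Finset.Ico b₁ b₂) (Finset.Ico b₁' b₂') ∧
              (Finset.range (2 ^ s)).filter (fun i => C (cls E) i = ω) = Finset.Ico b₁ b₂ ∪ Finset.Ico b₁' b₂') ∧
            ((Finset.range (2 ^ s)).image (C (cls E))).card ≤ 2 ^ (npp + 2) * (27 * a ^ 2 * b ^ 2) ^ 6 + 2 ^ 10)


end CubicClassTable

end Literature.Computability.Cryptography
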